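import Mathlib
import Summits.Ventures.PercRepro2.Defs
import Summits.Ventures.PercRepro2.Graph
import Summits.Ventures.PercRepro2.Events
import Summits.Ventures.PercRepro2.Harris
import Summits.Ventures.PercRepro2.Induced
import Summits.Ventures.PercRepro2.VdBKahn
import Summits.Ventures.PercRepro2.BHKAvoid
import Summits.Ventures.PercRepro2.PendantB

/-!
# The pendant-at-`b` row is a theorem: `PendantB.Row` for every `q ∈ [0, 1]`
(blind cell PercRepro2, mine-2 g13; MINE2-CUTVERTEX.md §13.21)

Under `Q = {a₁ ↮ a₂}` write `P = P(Q)`, `bL = P(Q, b ∈ C₁)`, `bH = P(Q, b ∈ C₂)`, `oL`, `oH` likewise,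
`A = P(Q, o ∈ C₁, b ∈ C₁)`, `B = P(Q, o ∈ C₂, b ∈ C₂)`, `C = P(Q, o ∈ C₂, b ∈ C₁)`,
`Dd = P(Q, o ∈ C₁, b ∈ C₂)`. The row `Row(q)` of `PendantB.lean` (the cleared `a₃`-free cubic of
`Gc` when `a₃` is a leaf at `b` with weight `q`) satisfies, with `q₀ = 1 − q`, `q₁ = q`,
`b₀ = P − bL − bH`, the polynomial identity

  `P · Row(q) = c₂ · P·M₂ + c₁ · P·M₁ + c₃ · (bH·V₃ + bL·X₃) + c₄ · (bL·V₄ + bH·X₄)`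

with the four landed blocks
* `M₂ = bL (oH − B − C) − b₀ C ≥ 0`, `M₁ = bH (oL − A − Dd) − b₀ Dd ≥ 0` — BHK06 Thm 1.4 with set
  avoidance (`bhk_cross_cluster_avoid`; source `a₂` resp. `a₁`, avoided set `{other root, b}`,
  up-sets `{W ∋ o}`, `{W ∋ b}`): «given `Q` and `o ∈ C₂`, the odds of `b ∈ C₁` against `b ∉ U` are
  at least the unconditional odds»;
* `V₃ = P A − oL bL ≥ 0`, `V₄ = P B − oH bH ≥ 0` — van den Berg–Kahn 1.2 (`vdBK`);
* `X₃ = oL bH − P Dd ≥ 0`, `X₄ = oH bL − P C ≥ 0` — `bhk_cross_cluster_avoid` with avoided set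
  `{other root}`;
and the brackets `c₁, …, c₄` polynomials with nonnegative coefficients in `q₀, q₁, bL, bH, b₀`:
`c₂ = 2b₀ + 2q₀²bL + 2q₀q₁bL + 2q₀²bH + 6q₀q₁bH + 4q₁²bH`, `c₁` its mirror,
`c₃ = 2q₀²P + 4q₀q₁bL + 2q₀q₁b₀`, `c₄ = 2q₀²P + 4q₀q₁bH + 2q₀q₁b₀`.
Hence `Row(q) ≥ 0` when `P > 0`; when `P = 0` every mass vanishes and `Row(q) = 0`.
With `PendantB.HCov_pendant_b_iff` this gives (HCOV) at every labelled instance whose `a₃` is a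
leaf at `b`, for every leaf weight, and closes the tenth two-far-mark cut-vertex class `{a₃, b}`.
-/

namespace Summit.Ventures.PercRepro2
namespace RowCert

variable {V : Type*} {E : Type*} [Fintype E] [DecidableEq E] [Fintype V] [DecidableEq V]
  {R : Type*} [Field R] [LinearOrder R] [IsStrictOrderedRing R]

omit [Fintype E] [DecidableEq E] [Fintype V] in
/-- Avoiding `{x, y}` is avoiding `x` and avoiding `y`. -/
lemma avoidAll_pair (ends : E → Sym2 V) (s x y : V) :
    avoidAll ends s {x} ∩ avoidAll ends s {y} = avoidAll ends s {x, y} := by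
  ext ω
  simp only [Set.mem_inter_iff, avoidAll, Set.mem_setOf_eq, Finset.mem_singleton,
    Finset.mem_insert, forall_eq, forall_eq_or_imp]

omit [Fintype E] [DecidableEq E] [Fintype V] [DecidableEq V] in
/-- `{s ↮ x} = {x ↮ s}`. -/
lemma avoidAll_swap (ends : E → Sym2 V) (s x : V) :
    avoidAll ends s {x} = avoidAll ends x {s} := by
  ext ω
  simp only [avoidAll, Set.mem_setOf_eq, Finset.mem_singleton, forall_eq]
  exact ⟨fun h h' => h (conn_symm h'), fun h h' => h (conn_symm h')⟩

omit [Fintype E] [DecidableEq E] [Fintype V] [DecidableEq V] in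
/-- `{s ↮ x} = {s ↔ x}ᶜ`. -/
lemma avoidAll_singleton_eq (ends : E → Sym2 V) (s x : V) :
    avoidAll ends s {x} = (connEvent ends s x)ᶜ := by
  ext ω
  simp only [avoidAll, Set.mem_setOf_eq, Finset.mem_singleton, forall_eq, Set.mem_compl_iff,
    mem_connEvent]

omit [Fintype E] [DecidableEq E] [Fintype V] [DecidableEq V] in
/-- `{C(s) ∋ v}` is the connection event `{s ↔ v}`. -/
lemma clusterInEvent_mem_eq (ends : E → Sym2 V) (s v : V) :
    clusterInEvent ends s {W | v ∈ W} = connEvent ends s v := by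
  ext ω
  simp only [mem_clusterInEvent, Set.mem_setOf_eq, cluster, mem_connEvent]

omit [Fintype E] [DecidableEq E] [Fintype V] [DecidableEq V] in
/-- The family of vertex sets containing `v` is an up-set. -/
lemma isUpperSet_mem (v : V) : IsUpperSet {W : Set V | v ∈ W} := fun _ _ h hW => h hW

omit [Fintype E] [DecidableEq E] [Fintype V] [DecidableEq V] in
/-- `connAll s {x} = {s ↔ x}`. -/
lemma connAll_singleton (ends : E → Sym2 V) (s x : V) :
    connAll ends s {x} = connEvent ends s x := by
  ext ω; simp [connAll]

omit [Fintype E] [DecidableEq E] [Fintype V] in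
/-- `connAll s {x, y} = {s ↔ x} ∩ {s ↔ y}`. -/
lemma connAll_pair (ends : E → Sym2 V) (s x y : V) :
    connAll ends s {x, y} = connEvent ends s x ∩ connEvent ends s y := by
  ext ω; simp [connAll]

omit [Fintype V] [DecidableEq V] [LinearOrder R] [IsStrictOrderedRing R] in
/-- `P(W) = P(W ∩ bL) + P(W ∩ bH) + P(W ∩ bLᶜ ∩ bHᶜ)` for a sub-event `W` of `Q`. -/
lemma prob_split_b (p : E → R) (ends : E → Sym2 V) (a₁ a₂ b : V) (W : Set (Config E))
    (hW : ∀ ω ∈ W, ¬ Conn ends ω a₂ a₁) :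
    prob p W = prob p (W ∩ connEvent ends a₁ b) + prob p (W ∩ connEvent ends a₂ b) +
      prob p (W ∩ (connEvent ends a₁ b)ᶜ ∩ (connEvent ends a₂ b)ᶜ) := by
  have h1 := prob_inter_add_prob_inter_compl p W (connEvent ends a₁ b)
  have h2 := prob_inter_add_prob_inter_compl p (W ∩ (connEvent ends a₁ b)ᶜ) (connEvent ends a₂ b)
  have h3 : W ∩ (connEvent ends a₁ b)ᶜ ∩ connEvent ends a₂ b = W ∩ connEvent ends a₂ b := by
    ext ω
    simp only [Set.mem_inter_iff, Set.mem_compl_iff, mem_connEvent]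
    constructor
    · rintro ⟨⟨h, _⟩, h2⟩; exact ⟨h, h2⟩
    · rintro ⟨h, h2⟩
      exact ⟨⟨h, fun h1 => hW ω h (conn_trans h2 (conn_symm h1))⟩, h2⟩
  rw [h3] at h2
  linear_combination -h1 - h2

omit [Fintype E] [DecidableEq E] [Fintype V] [DecidableEq V] [LinearOrder R] [IsStrictOrderedRing R] in
/-- The certificate identity: `P · Row(q)` as a combination of the four blocks (pure algebra). -/
lemma cert_identity (P bL bH oL oH A B C Dd q : R) :
    P * ((P * (A + B - C - Dd) - (bL - bH) * (oL - oH)) * (P - q * (bL + bH)) -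
      (1 - q) * (P ^ 2 * (A + B + C + Dd) - P * (oL + oH) * (bL + bH)) +
      q * (oL + oH - q * (A + B + C + Dd)) * (P * (bL + bH) - (bL - bH) ^ 2) -
      q * (P - q * (bL + bH)) * (P * (A + B + C + Dd) - (bL - bH) * (A + C - (Dd + B)))) =
      (2 * (P - bL - bH) + 2 * (1 - q) ^ 2 * bL + 2 * (1 - q) * q * bL +
          2 * (1 - q) ^ 2 * bH + 6 * (1 - q) * q * bH + 4 * q ^ 2 * bH) *
          (P * (bL * (oH - B - C) - (P - bL - bH) * C)) +
        (2 * (P - bL - bH) + 2 * (1 - q) ^ 2 * bH + 2 * (1 - q) * q * bH +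
          2 * (1 - q) ^ 2 * bL + 6 * (1 - q) * q * bL + 4 * q ^ 2 * bL) *
          (P * (bH * (oL - A - Dd) - (P - bL - bH) * Dd)) +
        (2 * (1 - q) ^ 2 * P + 4 * (1 - q) * q * bL + 2 * (1 - q) * q * (P - bL - bH)) *
          (bH * (P * A - oL * bL) + bL * (oL * bH - P * Dd)) +
        (2 * (1 - q) ^ 2 * P + 4 * (1 - q) * q * bH + 2 * (1 - q) * q * (P - bL - bH)) *
          (bL * (P * B - oH * bH) + bH * (oH * bL - P * C)) := by
  ring

set_option maxHeartbeats 400000 in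
/-- **`PendantB.Row` holds for every leaf weight `q ∈ [0, 1]`** (row 2′PEND-at-b; the tenth
two-far-mark cut-vertex class). -/
theorem row_nonneg (p : E → R) (hp : IsProbVec p) (ends : E → Sym2 V) (a₁ a₂ o b : V) (q : R)
    (hq0 : 0 ≤ q) (hq1 : q ≤ 1) : PendantB.Row p ends a₁ a₂ o b q := by
  unfold PendantB.Row
  intro Q P bL bH oL oH A B C Dd Sb So mbU moU Sig Ebo EQbo CovC
  have dP : P = prob p Q := rfl
  have dbL : bL = prob p (Q ∩ connEvent ends a₁ b) := rfl
  have dbH : bH = prob p (Q ∩ connEvent ends a₂ b) := rfl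
  have doL : oL = prob p (Q ∩ connEvent ends a₁ o) := rfl
  have doH : oH = prob p (Q ∩ connEvent ends a₂ o) := rfl
  have dA : A = prob p (Q ∩ (connEvent ends a₁ o ∩ connEvent ends a₁ b)) := rfl
  have dB : B = prob p (Q ∩ (connEvent ends a₂ o ∩ connEvent ends a₂ b)) := rfl
  have dC : C = prob p (Q ∩ (connEvent ends a₂ o ∩ connEvent ends a₁ b)) := rfl
  have dDd : Dd = prob p (Q ∩ (connEvent ends a₁ o ∩ connEvent ends a₂ b)) := rfl
  have dQ : Q = avoidAll ends a₂ {a₁} := rfl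
  have dSb : Sb = bL - bH := rfl
  have dSo : So = oL - oH := rfl
  have dmbU : mbU = bL + bH := rfl
  have dmoU : moU = oL + oH := rfl
  have dSig : Sig = A + B + C + Dd := rfl
  have dEbo : Ebo = A + C - (Dd + B) := rfl
  have dEQbo : EQbo = A + B - C - Dd := rfl
  have dCovC : CovC = P * EQbo - Sb * So := rfl
  clear_value Q P bL bH oL oH A B C Dd Sb So mbU moU Sig Ebo EQbo CovC
  subst dCovC dEQbo dEbo dSig dmoU dmbU dSo dSb
  -- membership facts under `Q`
  have hQ : ∀ ω ∈ Q, ¬ Conn ends ω a₂ a₁ := fun _ h => by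
    rw [dQ] at h; exact h a₁ (Finset.mem_singleton_self a₁)
  have hQ' : ∀ ω ∈ Q, ¬ Conn ends ω a₁ a₂ := fun ω h h' => hQ ω h (conn_symm h')
  -- `b₀ ≥ 0`
  have hsplit := prob_split_b p ends a₁ a₂ b Q hQ
  have hb0 : 0 ≤ P - bL - bH := by
    have := prob_nonneg hp (Q ∩ (connEvent ends a₁ b)ᶜ ∩ (connEvent ends a₂ b)ᶜ)
    linarith only [hsplit, dP, dbL, dbH, this]
  -- the avoidance events of the two sources
  have eQ1 : avoidAll ends a₁ {a₂} = Q := by rw [dQ, avoidAll_swap]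
  have eR2 : avoidAll ends a₂ {a₁, b} = Q ∩ (connEvent ends a₂ b)ᶜ := by
    rw [← avoidAll_pair, avoidAll_singleton_eq ends a₂ b, dQ]
  have eR1 : avoidAll ends a₁ {a₂, b} = Q ∩ (connEvent ends a₁ b)ᶜ := by
    rw [← avoidAll_pair, avoidAll_singleton_eq ends a₁ b, avoidAll_swap ends a₁ a₂, dQ]
  -- `bL ⊆ bHᶜ` and `bH ⊆ bLᶜ` under `Q`
  have sL : Q ∩ connEvent ends a₁ b ∩ (connEvent ends a₂ b)ᶜ = Q ∩ connEvent ends a₁ b := by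
    ext ω
    simp only [Set.mem_inter_iff, Set.mem_compl_iff, mem_connEvent]
    exact ⟨fun h => h.1, fun h => ⟨h, fun h2 => hQ ω h.1 (conn_trans h2 (conn_symm h.2))⟩⟩
  have sH : Q ∩ connEvent ends a₂ b ∩ (connEvent ends a₁ b)ᶜ = Q ∩ connEvent ends a₂ b := by
    ext ω
    simp only [Set.mem_inter_iff, Set.mem_compl_iff, mem_connEvent]
    exact ⟨fun h => h.1, fun h => ⟨h, fun h1 => hQ ω h.1 (conn_trans h.2 (conn_symm h1))⟩⟩
  -- ---------------------------------------------------------------- (M₂): `C (P − bH) ≤ (oH − B) bL`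
  have hM2 : C * (P - bH) ≤ (oH - B) * bL := by
    have key := bhk_cross_cluster_avoid p hp ends a₂ a₁ (X := {a₁, b}) (by simp)
      (isUpperSet_mem o) (isUpperSet_mem b)
    rw [clusterInEvent_mem_eq, clusterInEvent_mem_eq, eR2] at key
    have e1 : prob p (Q ∩ (connEvent ends a₂ b)ᶜ) = P - bH := by
      have := prob_inter_add_prob_inter_compl p Q (connEvent ends a₂ b)
      linarith only [this, dP, dbH]
    have e2 : connEvent ends a₂ o ∩ connEvent ends a₁ b ∩ (Q ∩ (connEvent ends a₂ b)ᶜ) =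
        Q ∩ (connEvent ends a₂ o ∩ connEvent ends a₁ b) := by
      ext ω
      simp only [Set.mem_inter_iff, Set.mem_compl_iff, mem_connEvent]
      constructor
      · rintro ⟨⟨ho, hb⟩, hq, _⟩; exact ⟨hq, ho, hb⟩
      · rintro ⟨hq, ho, hb⟩; exact ⟨⟨ho, hb⟩, hq, fun h2 => hQ ω hq (conn_trans h2 (conn_symm hb))⟩
    have e3 : prob p (connEvent ends a₂ o ∩ (Q ∩ (connEvent ends a₂ b)ᶜ)) = oH - B := by
      have h := prob_inter_add_prob_inter_compl p (Q ∩ connEvent ends a₂ o) (connEvent ends a₂ b)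
      have e : connEvent ends a₂ o ∩ (Q ∩ (connEvent ends a₂ b)ᶜ) =
          Q ∩ connEvent ends a₂ o ∩ (connEvent ends a₂ b)ᶜ := by
        ext ω; simp only [Set.mem_inter_iff]; tauto
      have e' : Q ∩ connEvent ends a₂ o ∩ connEvent ends a₂ b =
          Q ∩ (connEvent ends a₂ o ∩ connEvent ends a₂ b) := Set.inter_assoc _ _ _
      rw [e'] at h; rw [e]; linarith only [h, doH, dB]
    have e4 : prob p (connEvent ends a₁ b ∩ (Q ∩ (connEvent ends a₂ b)ᶜ)) = bL := by
      have e : connEvent ends a₁ b ∩ (Q ∩ (connEvent ends a₂ b)ᶜ) =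
          Q ∩ connEvent ends a₁ b ∩ (connEvent ends a₂ b)ᶜ := by
        ext ω; simp only [Set.mem_inter_iff]; tauto
      rw [e, sL, dbL]
    rw [e1, e2, e3, e4, ← dC] at key
    exact key
  -- ---------------------------------------------------------------- (M₁): `Dd (P − bL) ≤ (oL − A) bH`
  have hM1 : Dd * (P - bL) ≤ (oL - A) * bH := by
    have key := bhk_cross_cluster_avoid p hp ends a₁ a₂ (X := {a₂, b}) (by simp)
      (isUpperSet_mem o) (isUpperSet_mem b)
    rw [clusterInEvent_mem_eq, clusterInEvent_mem_eq, eR1] at key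
    have e1 : prob p (Q ∩ (connEvent ends a₁ b)ᶜ) = P - bL := by
      have := prob_inter_add_prob_inter_compl p Q (connEvent ends a₁ b)
      linarith only [this, dP, dbL]
    have e2 : connEvent ends a₁ o ∩ connEvent ends a₂ b ∩ (Q ∩ (connEvent ends a₁ b)ᶜ) =
        Q ∩ (connEvent ends a₁ o ∩ connEvent ends a₂ b) := by
      ext ω
      simp only [Set.mem_inter_iff, Set.mem_compl_iff, mem_connEvent]
      constructor
      · rintro ⟨⟨ho, hb⟩, hq, _⟩; exact ⟨hq, ho, hb⟩
      · rintro ⟨hq, ho, hb⟩; exact ⟨⟨ho, hb⟩, hq, fun h1 => hQ ω hq (conn_trans hb (conn_symm h1))⟩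
    have e3 : prob p (connEvent ends a₁ o ∩ (Q ∩ (connEvent ends a₁ b)ᶜ)) = oL - A := by
      have h := prob_inter_add_prob_inter_compl p (Q ∩ connEvent ends a₁ o) (connEvent ends a₁ b)
      have e : connEvent ends a₁ o ∩ (Q ∩ (connEvent ends a₁ b)ᶜ) =
          Q ∩ connEvent ends a₁ o ∩ (connEvent ends a₁ b)ᶜ := by
        ext ω; simp only [Set.mem_inter_iff]; tauto
      have e' : Q ∩ connEvent ends a₁ o ∩ connEvent ends a₁ b =
          Q ∩ (connEvent ends a₁ o ∩ connEvent ends a₁ b) := Set.inter_assoc _ _ _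
      rw [e'] at h; rw [e]; linarith only [h, doL, dA]
    have e4 : prob p (connEvent ends a₂ b ∩ (Q ∩ (connEvent ends a₁ b)ᶜ)) = bH := by
      have e : connEvent ends a₂ b ∩ (Q ∩ (connEvent ends a₁ b)ᶜ) =
          Q ∩ connEvent ends a₂ b ∩ (connEvent ends a₁ b)ᶜ := by
        ext ω; simp only [Set.mem_inter_iff]; tauto
      rw [e, sH, dbH]
    rw [e1, e2, e3, e4, ← dDd] at key
    exact key
  -- ---------------------------------------------------------------- (V₃): `oL bL ≤ P A` (van den Berg–Kahn)
  have hV3 : oL * bL ≤ P * A := by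
    have key := vdBK p hp ends a₁ {o} {b} {a₂} {a₂}
    have eAB : ({o} : Finset V) ∪ {b} = {o, b} := by
      ext t; simp only [Finset.mem_union, Finset.mem_singleton, Finset.mem_insert]
    have eXY : ({a₂} : Finset V) ∩ {a₂} = {a₂} := Finset.inter_self _
    have eXY' : ({a₂} : Finset V) ∪ {a₂} = {a₂} := Finset.union_self _
    rw [eAB, eXY, eXY', connAll_singleton, connAll_singleton, connAll_pair, eQ1] at key
    have e1 : connEvent ends a₁ o ∩ Q = Q ∩ connEvent ends a₁ o := Set.inter_comm _ _
    have e2 : connEvent ends a₁ b ∩ Q = Q ∩ connEvent ends a₁ b := Set.inter_comm _ _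
    have e3 : connEvent ends a₁ o ∩ connEvent ends a₁ b ∩ Q =
        Q ∩ (connEvent ends a₁ o ∩ connEvent ends a₁ b) := Set.inter_comm _ _
    rw [e1, e2, e3, ← doL, ← dbL, ← dA, ← dP] at key
    linarith only [key]
  -- ---------------------------------------------------------------- (V₄): `oH bH ≤ P B`
  have hV4 : oH * bH ≤ P * B := by
    have key := vdBK p hp ends a₂ {o} {b} {a₁} {a₁}
    have eAB : ({o} : Finset V) ∪ {b} = {o, b} := by
      ext t; simp only [Finset.mem_union, Finset.mem_singleton, Finset.mem_insert]
    have eXY : ({a₁} : Finset V) ∩ {a₁} = {a₁} := Finset.inter_self _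
    have eXY' : ({a₁} : Finset V) ∪ {a₁} = {a₁} := Finset.union_self _
    rw [eAB, eXY, eXY', connAll_singleton, connAll_singleton, connAll_pair] at key
    have e1 : connEvent ends a₂ o ∩ avoidAll ends a₂ {a₁} = Q ∩ connEvent ends a₂ o := by
      rw [dQ]; exact Set.inter_comm _ _
    have e2 : connEvent ends a₂ b ∩ avoidAll ends a₂ {a₁} = Q ∩ connEvent ends a₂ b := by
      rw [dQ]; exact Set.inter_comm _ _
    have e3 : connEvent ends a₂ o ∩ connEvent ends a₂ b ∩ avoidAll ends a₂ {a₁} =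
        Q ∩ (connEvent ends a₂ o ∩ connEvent ends a₂ b) := by
      rw [dQ]; exact Set.inter_comm _ _
    rw [e1, e2, e3, ← dQ, ← doH, ← dbH, ← dB, ← dP] at key
    linarith only [key]
  -- ---------------------------------------------------------------- (X₃): `P Dd ≤ oL bH` (cross cluster, avoid `a₂`)
  have hX3 : P * Dd ≤ oL * bH := by
    have key := bhk_cross_cluster_avoid p hp ends a₁ a₂ (X := {a₂}) (by simp)
      (isUpperSet_mem o) (isUpperSet_mem b)
    rw [clusterInEvent_mem_eq, clusterInEvent_mem_eq, eQ1] at key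
    have e1 : connEvent ends a₁ o ∩ connEvent ends a₂ b ∩ Q =
        Q ∩ (connEvent ends a₁ o ∩ connEvent ends a₂ b) := Set.inter_comm _ _
    have e2 : connEvent ends a₁ o ∩ Q = Q ∩ connEvent ends a₁ o := Set.inter_comm _ _
    have e3 : connEvent ends a₂ b ∩ Q = Q ∩ connEvent ends a₂ b := Set.inter_comm _ _
    rw [e1, e2, e3, ← dDd, ← doL, ← dbH, ← dP] at key
    linarith only [key]
  -- ---------------------------------------------------------------- (X₄): `P C ≤ oH bL`
  have hX4 : P * C ≤ oH * bL := by
    have key := bhk_cross_cluster_avoid p hp ends a₂ a₁ (X := {a₁}) (by simp)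
      (isUpperSet_mem o) (isUpperSet_mem b)
    rw [clusterInEvent_mem_eq, clusterInEvent_mem_eq] at key
    have e1 : connEvent ends a₂ o ∩ connEvent ends a₁ b ∩ avoidAll ends a₂ {a₁} =
        Q ∩ (connEvent ends a₂ o ∩ connEvent ends a₁ b) := by
      rw [dQ]; exact Set.inter_comm _ _
    have e2 : connEvent ends a₂ o ∩ avoidAll ends a₂ {a₁} = Q ∩ connEvent ends a₂ o := by
      rw [dQ]; exact Set.inter_comm _ _
    have e3 : connEvent ends a₁ b ∩ avoidAll ends a₂ {a₁} = Q ∩ connEvent ends a₁ b := by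
      rw [dQ]; exact Set.inter_comm _ _
    rw [e1, e2, e3, ← dQ, ← dC, ← doH, ← dbL, ← dP] at key
    linarith only [key]
  -- ---------------------------------------------------------------- the certificate
  have hP0 : 0 ≤ P := by rw [dP]; exact prob_nonneg hp _
  have hbL : 0 ≤ bL := by rw [dbL]; exact prob_nonneg hp _
  have hbH : 0 ≤ bH := by rw [dbH]; exact prob_nonneg hp _
  have hq0' : 0 ≤ 1 - q := by linarith only [hq1]
  -- nonnegative brackets
  have hc2 : 0 ≤ 2 * (P - bL - bH) + 2 * (1 - q) ^ 2 * bL + 2 * (1 - q) * q * bL +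
      2 * (1 - q) ^ 2 * bH + 6 * (1 - q) * q * bH + 4 * q ^ 2 * bH := by positivity
  have hc1 : 0 ≤ 2 * (P - bL - bH) + 2 * (1 - q) ^ 2 * bH + 2 * (1 - q) * q * bH +
      2 * (1 - q) ^ 2 * bL + 6 * (1 - q) * q * bL + 4 * q ^ 2 * bL := by positivity
  have hc3 : 0 ≤ 2 * (1 - q) ^ 2 * P + 4 * (1 - q) * q * bL + 2 * (1 - q) * q * (P - bL - bH) := by
    positivity
  have hc4 : 0 ≤ 2 * (1 - q) ^ 2 * P + 4 * (1 - q) * q * bH + 2 * (1 - q) * q * (P - bL - bH) := by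
    positivity
  -- nonnegative blocks (times `P` where needed)
  have hM2' : 0 ≤ bL * (oH - B - C) - (P - bL - bH) * C := by linarith only [hM2]
  have hM1' : 0 ≤ bH * (oL - A - Dd) - (P - bL - bH) * Dd := by linarith only [hM1]
  have hPM2 : 0 ≤ P * (bL * (oH - B - C) - (P - bL - bH) * C) := mul_nonneg hP0 hM2'
  have hPM1 : 0 ≤ P * (bH * (oL - A - Dd) - (P - bL - bH) * Dd) := mul_nonneg hP0 hM1'
  have hD3 : 0 ≤ bH * (P * A - oL * bL) + bL * (oL * bH - P * Dd) :=
    add_nonneg (mul_nonneg hbH (by linarith only [hV3])) (mul_nonneg hbL (by linarith only [hX3]))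
  have hD4 : 0 ≤ bL * (P * B - oH * bH) + bH * (oH * bL - P * C) :=
    add_nonneg (mul_nonneg hbL (by linarith only [hV4])) (mul_nonneg hbH (by linarith only [hX4]))
  -- `P · Row(q)` is a nonnegative combination of the four blocks
  have t1 := mul_nonneg hc2 hPM2
  have t2 := mul_nonneg hc1 hPM1
  have t3 := mul_nonneg hc3 hD3
  have t4 := mul_nonneg hc4 hD4
  have hid := cert_identity P bL bH oL oH A B C Dd q
  rcases hP0.lt_or_eq with hPpos | hPzero
  · refine (mul_nonneg_iff_of_pos_left hPpos).mp ?_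
    rw [hid]
    linarith only [t1, t2, t3, t4]
  · -- `P = 0`: every mass under `Q` vanishes
    have z : ∀ X : Set (Config E), prob p (Q ∩ X) = 0 := fun X =>
      le_antisymm (by calc prob p (Q ∩ X) ≤ prob p Q := prob_mono hp Set.inter_subset_left
                        _ = 0 := by rw [← dP]; exact hPzero.symm) (prob_nonneg hp _)
    have hbL0 : bL = 0 := by rw [dbL]; exact z _
    have hbH0 : bH = 0 := by rw [dbH]; exact z _
    have hoL0 : oL = 0 := by rw [doL]; exact z _
    have hoH0 : oH = 0 := by rw [doH]; exact z _
    have hA0 : A = 0 := by rw [dA]; exact z _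
    have hB0 : B = 0 := by rw [dB]; exact z _
    have hC0 : C = 0 := by rw [dC]; exact z _
    have hDd0 : Dd = 0 := by rw [dDd]; exact z _
    have hP0' : P = 0 := hPzero.symm
    subst hbL0 hbH0 hoL0 hoH0 hA0 hB0 hC0 hDd0 hP0'
    simp

/-- **(HCOV) at every pendant `a₃` attached to `b`**, for every leaf weight. -/
theorem HCov_pendant_b (p : E → R) (hp : IsProbVec p) (ends : E → Sym2 V) {f : E} {a₃ b : V}
    (hf : ends f = s(a₃, b)) (hleaf : ∀ e, a₃ ∈ ends e → e = f) (h3b : a₃ ≠ b) {o a₁ a₂ : V}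
    (h31 : a₃ ≠ a₁) (h32 : a₃ ≠ a₂) (ho : o ≠ a₃) :
    CovForm.HCov p ends o a₁ a₂ a₃ b :=
  (PendantB.HCov_pendant_b_iff p ends hf hleaf h3b h31 h32 ho).2
    (row_nonneg p hp ends a₁ a₂ o b (p f) (hp.nonneg f) (hp.le_one f))

end RowCert
end Summit.Ventures.PercRepro2
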